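import Mathlib.Analysis.Complex.ExponentialBounds
import Summits.AnomalousDissipation.AnomalousDissipation.Theorems.SawtoothPulseCascadeK1LocalisedCascadeLedgerSchedule
import Summits.AnomalousDissipation.AnomalousDissipation.Theorems.SawtoothPulseCascadeK1LocalisedCascadeLag

/-!
# K1loc, line `Spectral` / SeqCone — helper: THE CUT-OFF SCHEDULE AND THE DOMINATION TOOLS (S-B assembly, slot side)

Helper file of the prover lane on the crux `K1LocalisedCascade` (stmt-AnomalousDissipation-19491), route
`SawtoothPulseCascade` (S-B/S-C assembly seat).  The concrete half-slot steps `…K1Ledger.cascade_ledger_step_H_concrete`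
(ad-k1loc-p3) and `…cascade_ledger_step_V_concrete` leave the cut-off width `ε`, the flat-layer depth `M`, the symbol
parameters and the fibre scales symbolic.  `…LedgerSchedule` fixed the symbol side (`L_j = L₀ρ^j`, envelopes
`R_j = 2L₀Γ^j`, widths `w_j`); this file fixes the slot side and provides the elementary tools of the geometric
majorisation:
* §1 `exists_pow_mul_pow_le` — `(j+1)^p θ₁^j ≤ K θ₂^j` for `0 ≤ θ₁ < θ₂` (polynomial losses are absorbed by any
  strictly larger rate), and small order lemmas;
* §2 the CUT-OFF SCHEDULE `ε_j = 1/(1000·Γ^j)`, `Γ = (1+γ)² + 1` (forced by the residual-twist term, whose envelope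
  radius grows like `Γ^j`), and the FLAT-LAYER DEPTH `M_j = √(2·log(2000·Γ^j))` (so that `e^{−M_j²/2} = ε_j/2` exactly):
  `0 < ε_j ≤ 1/6`, `γ·4ε_j ≤ 1`, `1 ≤ M_j`, `e^{−M_j²/2} ≤ ε_j/2`, `M_j² ≤ M̄²(j+1)` and `M_j ≤ M̄(j+1)` with
  `M̄ = √(2 log(2000Γ))`, `M̄ ≤ 2π`, and `M_jδ_j ≤ π/2` for `δ₀ ≤ 1/4`, `d = 2`;
* §3 the frequencies at the crux point `N₀ = 1`, `ρN = 2`, `d = 2`: `N_j = 2^j`, `δ_j = δ₀/2^j`, `2πN_j/δ_j = (2π/δ₀)·4^j`;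
* §4 the V-slot fibre scale `b^V_j = L_j/(20(γ² + 29/20)(1+1/250))` and its six scale conditions.
No definitions; no statement about the stub. [cite: ElgindiLissMattingly2025, §1.2.1 and §1.2.2] [problem: turb]
-/

-- `Summit.<Summit>.<Problem>`: single-conjunct summit, the duplicate namespace segment is deliberate.
set_option linter.dupNamespace false

noncomputable section

namespace Summit.AnomalousDissipation.AnomalousDissipation.Theorems.SawtoothPulseCascade.K1Ledger

open Real Filter Topology
open Literature.Analysis.FluidPDE.SawtoothCascade Literature.Analysis.FluidPDE.SawtoothCascade.CascadeParams

/-! ## §1 Domination tools -/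

/-- **Polynomial times geometric is dominated by a faster geometric**: for `0 ≤ θ₁ < θ₂` and every `p` there is `K > 0`
with `(j+1)^p θ₁^j ≤ K θ₂^j` for all `j`. [folklore] -/
theorem exists_pow_mul_pow_le {θ₁ θ₂ : ℝ} (h₁ : 0 ≤ θ₁) (h₁₂ : θ₁ < θ₂) (p : ℕ) :
    ∃ K : ℝ, 0 < K ∧ ∀ j : ℕ, ((j : ℝ) + 1) ^ p * θ₁ ^ j ≤ K * θ₂ ^ j := by
  have h₂ : 0 < θ₂ := lt_of_le_of_lt h₁ h₁₂
  set q : ℝ := θ₁ / θ₂ with hq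
  have hq0 : 0 ≤ q := div_nonneg h₁ h₂.le
  have hq1 : q < 1 := (div_lt_one h₂).2 h₁₂
  have ht := tendsto_pow_const_mul_const_pow_of_abs_lt_one p (show |q| < 1 by rwa [abs_of_nonneg hq0])
  -- `(n+1)^p q^(n+1) → 0`, hence bounded by some `B ≥ 0`
  obtain ⟨B, hB⟩ := (ht.comp (tendsto_add_atTop_nat 1)).bddAbove_range
  have hBn : ∀ n : ℕ, (((n + 1 : ℕ) : ℝ)) ^ p * q ^ (n + 1) ≤ max B 0 := fun n =>
    (hB ⟨n, rfl⟩).trans (le_max_left _ _)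
  rcases eq_or_lt_of_le h₁ with h0 | hpos
  · -- `θ₁ = 0`
    refine ⟨1, one_pos, fun j => ?_⟩
    rcases Nat.eq_zero_or_pos j with rfl | hj
    · simp
    · rw [← h0, zero_pow hj.ne', mul_zero]; positivity
  · have hq0' : 0 < q := div_pos hpos h₂
    refine ⟨max B 0 / q + 1, by positivity, fun j => ?_⟩
    have hθj : θ₁ ^ j = q ^ j * θ₂ ^ j := by rw [hq, div_pow, div_mul_cancel₀ _ (pow_ne_zero _ h₂.ne')]
    have hkey : ((j : ℝ) + 1) ^ p * q ^ j ≤ max B 0 / q := by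
      rw [le_div_iff₀ hq0']
      have := hBn j
      push_cast at this
      calc ((j : ℝ) + 1) ^ p * q ^ j * q = ((j : ℝ) + 1) ^ p * q ^ (j + 1) := by ring
        _ ≤ max B 0 := this
    calc ((j : ℝ) + 1) ^ p * θ₁ ^ j = (((j : ℝ) + 1) ^ p * q ^ j) * θ₂ ^ j := by rw [hθj]; ring
      _ ≤ (max B 0 / q) * θ₂ ^ j := mul_le_mul_of_nonneg_right hkey (pow_nonneg h₂.le j)
      _ ≤ (max B 0 / q + 1) * θ₂ ^ j := by gcongr; linarith

/-- `j + 1 ≤ 2^j`. [folklore] -/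
theorem cast_add_one_le_two_pow (j : ℕ) : (j : ℝ) + 1 ≤ 2 ^ j := by
  have h : j + 1 ≤ 2 ^ j := Nat.lt_two_pow_self
  exact_mod_cast h

/-- `1 ≤ (j+1)`, cast. [folklore] -/
theorem one_le_cast_add_one (j : ℕ) : (1 : ℝ) ≤ (j : ℝ) + 1 := by
  have : (0 : ℝ) ≤ j := Nat.cast_nonneg j
  linarith

/-! ## §2 The cut-off schedule `ε_j = 1/(1000Γ^j)` and the flat-layer depth `M_j = √(2 log(2000Γ^j))` -/

/-- `1 ≤ Γ = (1+γ)² + 1`. [folklore] -/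
theorem one_le_Gamma (γ : ℝ) : (1 : ℝ) ≤ (1 + γ) ^ 2 + 1 := by nlinarith [sq_nonneg (1 + γ)]

/-- `Γ ≤ 82` for `γ ≤ 8`, `γ ≥ 5`. [folklore] -/
theorem Gamma_le {γ : ℝ} (hγ : 5 ≤ γ) (hγ' : γ ≤ 8) : (1 + γ) ^ 2 + 1 ≤ 82 := by nlinarith

/-- `0 < ε_j`. [folklore] -/
theorem eps_pos (γ : ℝ) (j : ℕ) : 0 < 1 / (1000 * ((1 + γ) ^ 2 + 1) ^ j) := by
  have := one_le_Gamma γ; positivity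

/-- `ε_j ≤ 1/1000`. [folklore] -/
theorem eps_le (γ : ℝ) (j : ℕ) : 1 / (1000 * ((1 + γ) ^ 2 + 1) ^ j) ≤ 1 / 1000 := by
  have h1 : (1 : ℝ) ≤ ((1 + γ) ^ 2 + 1) ^ j := one_le_pow₀ (one_le_Gamma γ)
  rw [div_le_div_iff₀ (by positivity) (by norm_num)]
  nlinarith

/-- `ε_j ≤ 1/6` (hypothesis `hε6` of the concrete steps). [folklore] -/
theorem eps_le_sixth (γ : ℝ) (j : ℕ) : 1 / (1000 * ((1 + γ) ^ 2 + 1) ^ j) ≤ 1 / 6 :=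
  (eps_le γ j).trans (by norm_num)

/-- `γ·(2·(2ε_j)) ≤ 1` for `γ ≤ 8` (hypothesis `hγε`). [folklore] -/
theorem gamma_mul_eps_le {γ : ℝ} (hγ : 5 ≤ γ) (hγ' : γ ≤ 8) (j : ℕ) :
    γ * (2 * (2 * (1 / (1000 * ((1 + γ) ^ 2 + 1) ^ j)))) ≤ 1 := by
  have h := eps_le γ j
  have h0 := eps_pos γ j
  nlinarith

/-- `1 ≤ 2000·Γ^j` (so the logarithm below is non-negative). [folklore] -/
theorem one_le_base (γ : ℝ) (j : ℕ) : (1 : ℝ) ≤ 2000 * ((1 + γ) ^ 2 + 1) ^ j := by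
  have h1 : (1 : ℝ) ≤ ((1 + γ) ^ 2 + 1) ^ j := one_le_pow₀ (one_le_Gamma γ)
  nlinarith

/-- **`e^{−M_j²/2} ≤ ε_j/2`** (hypothesis `hMε`; in fact an equality). [folklore] -/
theorem exp_neg_M_sq_le (γ : ℝ) (j : ℕ) :
    Real.exp (-(Real.sqrt (2 * Real.log (2000 * ((1 + γ) ^ 2 + 1) ^ j)) ^ 2 / 2)) ≤
      1 / (1000 * ((1 + γ) ^ 2 + 1) ^ j) / 2 := by
  have hb := one_le_base γ j
  have hb0 : 0 < 2000 * ((1 + γ) ^ 2 + 1) ^ j := by linarith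
  have hlog : 0 ≤ Real.log (2000 * ((1 + γ) ^ 2 + 1) ^ j) := Real.log_nonneg hb
  rw [Real.sq_sqrt (by positivity), show -(2 * Real.log (2000 * ((1 + γ) ^ 2 + 1) ^ j) / 2) =
    -Real.log (2000 * ((1 + γ) ^ 2 + 1) ^ j) by ring, Real.exp_neg, Real.exp_log hb0]
  apply le_of_eq
  field_simp
  ring

/-- **`1 ≤ M_j`** (hypothesis `hM`): `2 log(2000Γ^j) ≥ 2 log 2000 ≥ 1`. [folklore] -/
theorem one_le_M (γ : ℝ) (j : ℕ) : (1 : ℝ) ≤ Real.sqrt (2 * Real.log (2000 * ((1 + γ) ^ 2 + 1) ^ j)) := by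
  have h1 : (1 : ℝ) ≤ ((1 + γ) ^ 2 + 1) ^ j := one_le_pow₀ (one_le_Gamma γ)
  have he : Real.exp 1 ≤ 2000 * ((1 + γ) ^ 2 + 1) ^ j := by
    have := Real.exp_one_lt_d9; nlinarith
  have hl : 1 ≤ Real.log (2000 * ((1 + γ) ^ 2 + 1) ^ j) := by
    have h := Real.log_le_log (Real.exp_pos 1) he
    rwa [Real.log_exp] at h
  refine (Real.le_sqrt zero_le_one (by linarith)).2 ?_
  linarith

/-- `0 ≤ M_j`. [folklore] -/
theorem M_nonneg (γ : ℝ) (j : ℕ) : (0 : ℝ) ≤ Real.sqrt (2 * Real.log (2000 * ((1 + γ) ^ 2 + 1) ^ j)) :=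
  Real.sqrt_nonneg _

/-- **`M_j² ≤ M̄²·(j+1)`** with `M̄ = √(2 log(2000Γ))`: `log(2000Γ^j) = log 2000 + j log Γ ≤ (j+1) log(2000Γ)`.
[folklore] -/
theorem M_sq_le (γ : ℝ) (j : ℕ) :
    Real.sqrt (2 * Real.log (2000 * ((1 + γ) ^ 2 + 1) ^ j)) ^ 2 ≤
      Real.sqrt (2 * Real.log (2000 * ((1 + γ) ^ 2 + 1))) ^ 2 * ((j : ℝ) + 1) := by
  have hG := one_le_Gamma γ
  have hG0 : 0 < (1 + γ) ^ 2 + 1 := by linarith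
  have hb := one_le_base γ j
  have hb1 := one_le_base γ 1
  rw [pow_one] at hb1
  rw [Real.sq_sqrt (by linarith [Real.log_nonneg hb]), Real.sq_sqrt (by linarith [Real.log_nonneg hb1]),
    Real.log_mul (by norm_num) (pow_ne_zero _ hG0.ne'), Real.log_mul (by norm_num) hG0.ne', Real.log_pow]
  have hl2 : 0 ≤ Real.log 2000 := Real.log_nonneg (by norm_num)
  have hlG : 0 ≤ Real.log ((1 + γ) ^ 2 + 1) := Real.log_nonneg hG
  have hj : (0 : ℝ) ≤ j := Nat.cast_nonneg j
  nlinarith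

/-- **`M_j ≤ M̄·(j+1)`**. [folklore] -/
theorem M_le (γ : ℝ) (j : ℕ) :
    Real.sqrt (2 * Real.log (2000 * ((1 + γ) ^ 2 + 1) ^ j)) ≤
      Real.sqrt (2 * Real.log (2000 * ((1 + γ) ^ 2 + 1))) * ((j : ℝ) + 1) := by
  have h := M_sq_le γ j
  have hj1 := one_le_cast_add_one j
  have hM0 := M_nonneg γ j
  have hMb0 : 0 ≤ Real.sqrt (2 * Real.log (2000 * ((1 + γ) ^ 2 + 1))) := Real.sqrt_nonneg _
  have h2 : Real.sqrt (2 * Real.log (2000 * ((1 + γ) ^ 2 + 1) ^ j)) ^ 2 ≤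
      (Real.sqrt (2 * Real.log (2000 * ((1 + γ) ^ 2 + 1))) * ((j : ℝ) + 1)) ^ 2 := by
    refine h.trans ?_
    rw [mul_pow]
    exact mul_le_mul_of_nonneg_left (by nlinarith) (sq_nonneg _)
  exact (pow_le_pow_iff_left₀ hM0 (by positivity) (by norm_num : (2 : ℕ) ≠ 0)).1 h2

/-- **`M̄ ≤ 2π`** for `γ ≤ 8`: `2 log(2000·82) ≤ 2·18·log 2 < 26 < 4π²`. [folklore] -/
theorem Mbar_le_two_pi {γ : ℝ} (hγ : 5 ≤ γ) (hγ' : γ ≤ 8) :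
    Real.sqrt (2 * Real.log (2000 * ((1 + γ) ^ 2 + 1))) ≤ 2 * Real.pi := by
  have hG := Gamma_le hγ hγ'
  have hG1 := one_le_Gamma γ
  have hb : 2000 * ((1 + γ) ^ 2 + 1) ≤ (2 : ℝ) ^ 18 := by nlinarith
  have hb0 : 0 < 2000 * ((1 + γ) ^ 2 + 1) := by nlinarith
  have hlog : Real.log (2000 * ((1 + γ) ^ 2 + 1)) ≤ 18 * Real.log 2 := by
    have h := Real.log_le_log hb0 hb
    rw [Real.log_pow] at h
    exact_mod_cast h
  have hl2 := Real.log_two_lt_d9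
  have hπ := Real.pi_gt_three
  rw [show 2 * Real.pi = Real.sqrt ((2 * Real.pi) ^ 2) by rw [Real.sqrt_sq (by positivity)]]
  exact Real.sqrt_le_sqrt (by nlinarith)

/-! ## §3 The crux point `N₀ = 1`, `ρN = 2`, `d = 2` -/

/-- `N_j = 2^j` at the crux point. [folklore] -/
theorem N_cast_eq (P : CascadeParams) (hN₀ : P.N₀ = 1) (hρN : P.ρN = 2) (j : ℕ) : (P.N j : ℝ) = 2 ^ j := by
  simp [CascadeParams.N, hN₀, hρN]

/-- `N_j ≠ 0` at the crux point. [folklore] -/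
theorem N_ne_zero (P : CascadeParams) (hN₀ : P.N₀ = 1) (hρN : P.ρN = 2) (j : ℕ) : P.N j ≠ 0 := by
  simp [CascadeParams.N, hN₀, hρN]

/-- `δ_j = δ₀/2^j` at the crux point. [folklore] -/
theorem delta_eq (P : CascadeParams) (hd : P.d = 2) (j : ℕ) : P.δ j = P.δ₀ / 2 ^ j := by
  simp [CascadeParams.δ, hd]

/-- `Λ_j = 2πN_j/δ_j = (2π/δ₀)·4^j` at the crux point. [folklore] -/
theorem Lambda_eq (P : CascadeParams) (hN₀ : P.N₀ = 1) (hρN : P.ρN = 2) (hd : P.d = 2) (hδ₀ : 0 < P.δ₀) (j : ℕ) :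
    2 * Real.pi * P.N j / P.δ j = 2 * Real.pi / P.δ₀ * 4 ^ j := by
  rw [N_cast_eq P hN₀ hρN, delta_eq P hd, show (4 : ℝ) ^ j = 2 ^ j * 2 ^ j by rw [← mul_pow]; norm_num]
  field_simp

/-- **`M_jδ_j ≤ π/2`** at the crux point for `δ₀ ≤ 1/4` (hypothesis `hMδ`): `M_j ≤ M̄(j+1) ≤ 2π·2^j` and
`δ_j = δ₀/2^j`. [folklore] -/
theorem M_mul_delta_le (P : CascadeParams) (hγ : 5 ≤ P.γ) (hγ' : P.γ ≤ 8) (hδ₀ : 0 < P.δ₀) (hδ₀' : P.δ₀ ≤ 1 / 4)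
    (hd : P.d = 2) (j : ℕ) :
    Real.sqrt (2 * Real.log (2000 * ((1 + P.γ) ^ 2 + 1) ^ j)) * P.δ j ≤ Real.pi / 2 := by
  rw [delta_eq P hd]
  have h1 := M_le P.γ j
  have h2 := Mbar_le_two_pi hγ hγ'
  have h3 := cast_add_one_le_two_pow j
  have hπ := Real.pi_pos
  have h2j : (0 : ℝ) < 2 ^ j := by positivity
  have hM : Real.sqrt (2 * Real.log (2000 * ((1 + P.γ) ^ 2 + 1) ^ j)) ≤ 2 * Real.pi * 2 ^ j :=
    h1.trans ((mul_le_mul h2 h3 (by positivity) (by positivity)).trans le_rfl)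
  calc Real.sqrt (2 * Real.log (2000 * ((1 + P.γ) ^ 2 + 1) ^ j)) * (P.δ₀ / 2 ^ j)
      ≤ 2 * Real.pi * 2 ^ j * (P.δ₀ / 2 ^ j) := mul_le_mul_of_nonneg_right hM (by positivity)
    _ = 2 * Real.pi * P.δ₀ := by field_simp
    _ ≤ Real.pi / 2 := by nlinarith

/-! ## §4 The V-slot fibre scale `b^V_j = L_j/(20(γ² + 29/20)(1 + 1/250))` -/

/-- `0 < b^V_j`. [folklore] -/
theorem bV_pos {γ L₀ : ℝ} (hγ : 5 ≤ γ) (hγ' : γ ≤ 8) (hL₀ : 1000 ≤ L₀) (j : ℕ) :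
    0 < L₀ * ((γ ^ 2 - 5 / 2) / (1 + 1 / 250) ^ 2 - 1 / (2 * (1 + 1 / 250) * L₀)) ^ j /
      (20 * (γ ^ 2 + 29 / 20) * (1 + 1 / 250)) :=
  div_pos (L_pos hγ hγ' hL₀ j) (by positivity)

/-- **Old-symbol cone scale** (`b(γ² + a₂) ≤ ε_a·L_j/(1+ε)` of `…K1Symbol.exists_fibre_data_symProdM_V`; an equality).
[folklore] -/
theorem bV_mul_le {γ L₀ : ℝ} (hγ : 5 ≤ γ) (j : ℕ) :
    L₀ * ((γ ^ 2 - 5 / 2) / (1 + 1 / 250) ^ 2 - 1 / (2 * (1 + 1 / 250) * L₀)) ^ j /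
        (20 * (γ ^ 2 + 29 / 20) * (1 + 1 / 250)) * (γ ^ 2 + 29 / 20) ≤
      1 / 20 * (L₀ * ((γ ^ 2 - 5 / 2) / (1 + 1 / 250) ^ 2 - 1 / (2 * (1 + 1 / 250) * L₀)) ^ j / (1 + 1 / 250)) := by
  have hγ2 : 0 < γ ^ 2 + 29 / 20 := by positivity
  apply le_of_eq; field_simp

/-- **Old-symbol radial scale** (`b ≤ ε·(L_j/(1+ε))`). [folklore] -/
theorem bV_le_radial {γ L₀ : ℝ} (hγ : 5 ≤ γ) (hγ' : γ ≤ 8) (hL₀ : 1000 ≤ L₀) (j : ℕ) :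
    L₀ * ((γ ^ 2 - 5 / 2) / (1 + 1 / 250) ^ 2 - 1 / (2 * (1 + 1 / 250) * L₀)) ^ j /
        (20 * (γ ^ 2 + 29 / 20) * (1 + 1 / 250)) ≤
      1 / 250 * (L₀ * ((γ ^ 2 - 5 / 2) / (1 + 1 / 250) ^ 2 - 1 / (2 * (1 + 1 / 250) * L₀)) ^ j / (1 + 1 / 250)) := by
  have hLp := L_pos hγ hγ' hL₀ j
  rw [div_le_iff₀ (by positivity)]
  have : 1 / 250 * (L₀ * ((γ ^ 2 - 5 / 2) / (1 + 1 / 250) ^ 2 - 1 / (2 * (1 + 1 / 250) * L₀)) ^ j / (1 + 1 / 250)) *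
      (20 * (γ ^ 2 + 29 / 20) * (1 + 1 / 250)) =
      (L₀ * ((γ ^ 2 - 5 / 2) / (1 + 1 / 250) ^ 2 - 1 / (2 * (1 + 1 / 250) * L₀)) ^ j) *
        (20 * (γ ^ 2 + 29 / 20) / 250) := by field_simp
  rw [this]
  have h2 : (1 : ℝ) ≤ 20 * (γ ^ 2 + 29 / 20) / 250 := by rw [le_div_iff₀ (by norm_num)]; nlinarith
  nlinarith

/-- **Old-symbol envelope scale** (`b ≤ w_j`). [folklore] -/
theorem bV_le_w {γ L₀ : ℝ} (hγ : 5 ≤ γ) (hγ' : γ ≤ 8) (hL₀ : 1000 ≤ L₀) (j : ℕ) :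
    L₀ * ((γ ^ 2 - 5 / 2) / (1 + 1 / 250) ^ 2 - 1 / (2 * (1 + 1 / 250) * L₀)) ^ j /
        (20 * (γ ^ 2 + 29 / 20) * (1 + 1 / 250)) ≤
      L₀ * ((γ ^ 2 - 5 / 2) / (1 + 1 / 250) ^ 2 - 1 / (2 * (1 + 1 / 250) * L₀)) ^ j / (20 * γ * (1 + 1 / 250)) := by
  have hLp := L_pos hγ hγ' hL₀ j
  exact div_le_div_of_nonneg_left hLp.le (by positivity) (by nlinarith)

/-- **New-symbol radial scale** (`b ≤ ε·L_{j+1}`). [folklore] -/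
theorem bV_le_radial_succ {γ L₀ : ℝ} (hγ : 5 ≤ γ) (hγ' : γ ≤ 8) (hL₀ : 1000 ≤ L₀) (j : ℕ) :
    L₀ * ((γ ^ 2 - 5 / 2) / (1 + 1 / 250) ^ 2 - 1 / (2 * (1 + 1 / 250) * L₀)) ^ j /
        (20 * (γ ^ 2 + 29 / 20) * (1 + 1 / 250)) ≤
      1 / 250 * (L₀ * ((γ ^ 2 - 5 / 2) / (1 + 1 / 250) ^ 2 - 1 / (2 * (1 + 1 / 250) * L₀)) ^ (j + 1)) := by
  refine (bV_le_radial hγ hγ' hL₀ j).trans ?_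
  have hLp := L_pos hγ hγ' hL₀ j
  have hL0 : 0 < L₀ := by linarith
  have hρ1 := one_le_rho hγ hγ' hL₀
  have h1 : L₀ * ((γ ^ 2 - 5 / 2) / (1 + 1 / 250) ^ 2 - 1 / (2 * (1 + 1 / 250) * L₀)) ^ j / (1 + 1 / 250) ≤
      L₀ * ((γ ^ 2 - 5 / 2) / (1 + 1 / 250) ^ 2 - 1 / (2 * (1 + 1 / 250) * L₀)) ^ j := div_le_self hLp.le (by norm_num)
  have h2 : L₀ * ((γ ^ 2 - 5 / 2) / (1 + 1 / 250) ^ 2 - 1 / (2 * (1 + 1 / 250) * L₀)) ^ j ≤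
      L₀ * ((γ ^ 2 - 5 / 2) / (1 + 1 / 250) ^ 2 - 1 / (2 * (1 + 1 / 250) * L₀)) ^ (j + 1) :=
    mul_le_mul_of_nonneg_left (pow_le_pow_right₀ hρ1 (Nat.le_succ j)) hL0.le
  nlinarith

/-- **New-symbol cone scale** (`b·a ≤ ε_a·L_{j+1}`, `a = 13/10`). [folklore] -/
theorem bV_mul_a_le {γ L₀ : ℝ} (hγ : 5 ≤ γ) (hγ' : γ ≤ 8) (hL₀ : 1000 ≤ L₀) (j : ℕ) :
    L₀ * ((γ ^ 2 - 5 / 2) / (1 + 1 / 250) ^ 2 - 1 / (2 * (1 + 1 / 250) * L₀)) ^ j /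
        (20 * (γ ^ 2 + 29 / 20) * (1 + 1 / 250)) * (13 / 10) ≤
      1 / 20 * (L₀ * ((γ ^ 2 - 5 / 2) / (1 + 1 / 250) ^ 2 - 1 / (2 * (1 + 1 / 250) * L₀)) ^ (j + 1)) := by
  have h := bV_le_radial_succ hγ hγ' hL₀ j
  have hLp := L_pos hγ hγ' hL₀ (j + 1)
  nlinarith

/-- **New-symbol envelope scale** (`b ≤ w_{j+1}`). [folklore] -/
theorem bV_le_w_succ {γ L₀ : ℝ} (hγ : 5 ≤ γ) (hγ' : γ ≤ 8) (hL₀ : 1000 ≤ L₀) (j : ℕ) :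
    L₀ * ((γ ^ 2 - 5 / 2) / (1 + 1 / 250) ^ 2 - 1 / (2 * (1 + 1 / 250) * L₀)) ^ j /
        (20 * (γ ^ 2 + 29 / 20) * (1 + 1 / 250)) ≤
      L₀ * ((γ ^ 2 - 5 / 2) / (1 + 1 / 250) ^ 2 - 1 / (2 * (1 + 1 / 250) * L₀)) ^ (j + 1) / (20 * γ * (1 + 1 / 250)) := by
  refine (bV_le_w hγ hγ' hL₀ j).trans ?_
  have hLp := L_pos hγ hγ' hL₀ j
  have hρ1 := one_le_rho hγ hγ' hL₀
  have hL0 : 0 < L₀ := by linarith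
  exact div_le_div_of_nonneg_right (mul_le_mul_of_nonneg_left (pow_le_pow_right₀ hρ1 (Nat.le_succ j)) hL0.le)
    (by positivity)

/-- The H widths grow: `w_j ≤ w_{j+1}` (so the H-scale `b_j = w_j` also satisfies `b ≤ w′ = w_j`, trivially, and the
bookkeeping across phases is monotone). [folklore] -/
theorem w_le_w_succ {γ L₀ : ℝ} (hγ : 5 ≤ γ) (hγ' : γ ≤ 8) (hL₀ : 1000 ≤ L₀) (j : ℕ) :
    L₀ * ((γ ^ 2 - 5 / 2) / (1 + 1 / 250) ^ 2 - 1 / (2 * (1 + 1 / 250) * L₀)) ^ j / (20 * γ * (1 + 1 / 250)) ≤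
      L₀ * ((γ ^ 2 - 5 / 2) / (1 + 1 / 250) ^ 2 - 1 / (2 * (1 + 1 / 250) * L₀)) ^ (j + 1) / (20 * γ * (1 + 1 / 250)) := by
  have hLp := L_pos hγ hγ' hL₀ j
  have hρ1 := one_le_rho hγ hγ' hL₀
  have hγ0 : 0 < γ := by linarith
  have hL0 : 0 < L₀ := by linarith
  exact div_le_div_of_nonneg_right (mul_le_mul_of_nonneg_left (pow_le_pow_right₀ hρ1 (Nat.le_succ j)) hL0.le)
    (by positivity)

end Summit.AnomalousDissipation.AnomalousDissipation.Theorems.SawtoothPulseCascade.K1Ledger
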